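import Mathlib.Analysis.Calculus.ParametricIntegral
import Mathlib.Analysis.Calculus.Deriv.Shift
import Mathlib.Analysis.Normed.Algebra.MatrixExponential
import Literature.MathematicalPhysics.QuantumFieldTheory.Balaban1983to89.B10Eq18SigmaSU2Haar
import Literature.MathematicalPhysics.QuantumFieldTheory.ContinuumLimitsYM2Haar
import Literature.MathematicalPhysics.QuantumLattice.GaugeGroups
import HarnessLib

/-!
# Link transport derivations on `SU(2)` lattice gauge fields and their Haar calculus

The RIGHT-TRANSLATION DERIVATION of a function of the link variables `U : Edge d L → SU(2)` along ONE
link `e`, in a state-dependent direction `v(U) ∈ ℝ³ ≅ 𝔰𝔲(2)` attached to that link,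

  `(∂_{e,v} ψ)(U) = d/dt|_{t=0} ψ(U with U(e) ↦ U(e)·exp(i t Σ_a v_a(U) σ_a))`

(`linkDerivation`; the chart `A ↦ exp(iΣσ_aA^a)` is the tree's `expPauli` of
`Balaban1983to89.B10Eq18SigmaSU2Haar`), the TRANSPORT DERIVATION `X_c ψ = Σ_x ∂_{(x,0), c x} ψ` summed
over the direction-`0` links of the three-torus with a frame `c x (U)` at every site (`transportDerivation`,
the vector field `X = Σ_x A_x(U)·∂_{U(x,0)}` of the lattice-gauge uncertainty / current constructions), and
their calculus with respect to the PRODUCT HAAR MEASURE `Π_e dU(e)` (`Measure.pi fun _ => haarProbability SU2`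
= the tree's `Luscher2010.trivialMeasure` = the `configMeasure` of the transfer-operator files):

* §1 Definitions: the link flow `linkShift e v t` (right multiplication of `U(e)` by `expPauli (t • v U)`),
  `linkDerivation`, `transportDerivation` (unfolds by `rfl` to the `let X` term inlined in the route items it
  serves), and the regularity class `LinkRegular e v ψ` (measurable, bounded, differentiable along the flow at
  `t = 0` at every configuration, with measurable bounded derivative).
* §2 The flow: `linkShift e v 0 = id`; when the direction field `v` does not read the link `e`
  (`DependsOn v {e}ᶜ`) the flow is a one-parameter group, `Φ_s ∘ Φ_t = Φ_{t+s}`, so differentiability at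
  `t = 0` everywhere propagates to every `t`; measurability.
* §3 HAAR DIVERGENCE-FREENESS (the «renaming move»): for `v` blind to `e`, every `Φ_t` preserves the product
  Haar measure — right invariance `∫ f(UV) dU = ∫ f(U) dU` of the one-link Haar measure
  [Montvay–Münster (3.90)] applied under the other links (tree lemma `YM2.lintegral_eq_of_update_mul`);
  hence `∫ ψ ∘ Φ_t = ∫ ψ`.
* §4 INTEGRATION BY PARTS `∫ ∂_{e,v} ψ dU = 0` (`integral_linkDerivation_eq_zero`) and
  `∫ X_c ψ dU = 0` (`integral_transportDerivation_eq_zero`, alias `haar_div_free_of_avoids_link`):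
  differentiate the constant `t ↦ ∫ ψ ∘ Φ_t` under the integral sign (dominated convergence with the
  uniform derivative bound) — Lüscher's right-invariant link operators `∂^a_{x,μ}` are symmetric-making for
  `∫ D[U]` exactly by this identity [Lüscher 2010, §2.2 eq. (2.2), §4.2 eqs. (4.7)–(4.8)].
* §5 PRODUCT RULE `∂(fg) = (∂f)g + f(∂g)`, `X(fg) = (Xf)g + f(Xg)` and the corollaries: ANTISYMMETRY
  `∫ (Xf) g = −∫ f (Xg)` and `∫ (XΩ) Ω = 0`.

Design. The measure-preservation part (§3) is proved for an arbitrary compact group `G` and an arbitrary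
measurable multiplier `k(U)` blind to `e` (`map_linkMul_pi_haarProbability`); the differential part is specific
to `SU(2)` and the tree's Pauli chart `expPauli`, because the consumers (routes `TransportFieldFano`,
`CovariantCurrentDoor` of the Yang–Mills femto programme) inline exactly that chart.  Regularity is an explicit
hypothesis structure (`LinkRegular`), not smoothness on the ambient matrix space: the consumers feed transfer-
operator eigenfunctions whose link-flow differentiability they establish separately.  `deriv` junk values never
enter a conclusion: every theorem that mentions a derivative assumes differentiability at the point used.

NOT here (summit vocabulary, by design): the concrete frames (neighbouring Polyakov loop, covariantly smoothed
Polyakov colour), physical test functions `IsPhys`, the transfer operator and its eigenfunctions, any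
`β`-dependent estimate.

## References
* I. Montvay, G. Münster, *Quantum Fields on a Lattice*, CUP (1994), §3.2.3 eqs. (3.90)–(3.92) (invariance and
  normalisation of the Haar measure of the link variables) [MontvayMunster1994].
* M. Lüscher, *Trivializing maps, the Wilson flow and the HMC algorithm*, CMP 293 (2010) 899–919, §2.2
  eqs. (2.2)–(2.4) (link differential operators `∂^a_{x,μ} f(U) = d/dt f(U_t)|_{t=0}`, the one-forms
  `θ^a_{x,μ}` and `df = Σ θ^a_{x,μ} ∂^a_{x,μ} f`), §4.2 eqs. (4.7)–(4.8)
  (symmetry / positivity of `Σ ∂^a∂^a` in `L²(D[U])`, i.e. integration by parts) [Luscher2010Trivializing].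
* M. Reed, B. Simon, *Methods of Modern Mathematical Physics IV* (1978), Thm. XIII.1 ff. (the variational
  set-up these identities serve) [ReedSimonIV1978].
-/

noncomputable section

open MeasureTheory Filter Function Set
open scoped Topology ENNReal

namespace Literature.MathematicalPhysics.QuantumFieldTheory.LinkTransport

open Literature.MathematicalPhysics.QuantumFieldTheory (GaugeConfig Site Edge Site.shift haarProbability SU2)
open Literature.MathematicalPhysics.QuantumFieldTheory.Balaban1983to89.B10Eq18SigmaSU2Haar
  (expPauli coe_expPauli expPauli_zero continuous_expPauli measurable_expPauli)

/-! ## §1 Definitions -/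

section Defs

variable {d L : ℕ}

/-- **The link flow.** `linkShift e v t U` is the configuration `U` with the single link `e` right-translated
by the one-parameter subgroup generated by the direction `v U ∈ ℝ³ ≅ 𝔰𝔲(2)` read off the configuration:
`U(e) ↦ U(e) · exp(i t Σ_a v_a(U) σ_a)`, all other links fixed (Lüscher's `U_t` of eq. (2.2), right- instead
of left-translation, with a field-dependent generator). [cite: Luscher2010Trivializing, §2.2 eq. (2.2)] -/
def linkShift (e : Edge d L) (v : GaugeConfig d L SU2 → EuclideanSpace ℝ (Fin 3)) (t : ℝ)
    (U : GaugeConfig d L SU2) : GaugeConfig d L SU2 :=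
  Function.update U e (U e * expPauli (t • v U))

/-- **The link derivation** `(∂_{e,v} ψ)(U) = d/dt|_{t=0} ψ(linkShift e v t U)`: the derivative of `ψ` along
the right translation of the link `e` in the direction `v(U)` (Lüscher's `∂^a_{x,μ} f(U) = d/dt f(U_t)|_{t=0}`,
eq. (2.2), for the generator `iΣ v_a σ_a` instead of a fixed basis element `T^a`).  A `deriv`, so `0` where the
derivative does not exist; every theorem below that uses it assumes differentiability.
[cite: Luscher2010Trivializing, §2.2 eq. (2.2)] -/
def linkDerivation (e : Edge d L) (v : GaugeConfig d L SU2 → EuclideanSpace ℝ (Fin 3))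
    (ψ : GaugeConfig d L SU2 → ℝ) (U : GaugeConfig d L SU2) : ℝ :=
  deriv (fun t : ℝ => ψ (linkShift e v t U)) 0

/-- **The transport derivation** on the direction-`0` links of the three-torus `(ℤ/L)³`: for a frame
`c x (U) ∈ ℝ³` at every site, `(X_c ψ)(U) = Σ_x d/dt|_{t=0} ψ(U with U(x,0) ↦ U(x,0)·exp(i t Σ_a (c x U)_a σ_a))`
— the first-order differential operator `X_c = Σ_x (c x)^a ∂^a_{(x,0)}` (right translations) acting on
functions of the gauge field (Lüscher's expansion `Σ_{x,μ} θ^a_{x,μ} ∂^a_{x,μ}` of a vector field in the link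
operators, eq. (2.4), restricted to `μ = 0`). [cite: Luscher2010Trivializing, §2.2 eqs. (2.2)–(2.4)] -/
def transportDerivation [NeZero L] (c : Site 3 L → GaugeConfig 3 L SU2 → EuclideanSpace ℝ (Fin 3))
    (ψ : GaugeConfig 3 L SU2 → ℝ) (U : GaugeConfig 3 L SU2) : ℝ :=
  ∑ x : Site 3 L, deriv (fun t : ℝ => ψ (Function.update U (x, (0 : Fin 3))
    (U (x, (0 : Fin 3)) * expPauli (t • c x U)))) 0

/-- `transportDerivation` is LITERALLY the sum of `deriv`s inlined in the route items (`rfl`).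
[cite: Luscher2010Trivializing, §2.2 eqs. (2.2)–(2.4)] -/
theorem transportDerivation_eq [NeZero L] (c : Site 3 L → GaugeConfig 3 L SU2 → EuclideanSpace ℝ (Fin 3))
    (ψ : GaugeConfig 3 L SU2 → ℝ) (U : GaugeConfig 3 L SU2) :
    transportDerivation c ψ U = ∑ x : Site 3 L, deriv (fun t : ℝ => ψ (Function.update U (x, (0 : Fin 3))
      (U (x, (0 : Fin 3)) * expPauli (t • c x U)))) 0 := rfl

/-- `transportDerivation` is the sum over sites of the link derivations along the direction-`0` links.
[cite: Luscher2010Trivializing, §2.2 eqs. (2.2)–(2.4)] -/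
theorem transportDerivation_eq_sum_linkDerivation [NeZero L]
    (c : Site 3 L → GaugeConfig 3 L SU2 → EuclideanSpace ℝ (Fin 3)) (ψ : GaugeConfig 3 L SU2 → ℝ)
    (U : GaugeConfig 3 L SU2) :
    transportDerivation c ψ U = ∑ x : Site 3 L, linkDerivation (x, (0 : Fin 3)) (c x) ψ U := rfl

/-- **Regularity of `ψ` along the link flow `(e, v)`** — exactly what the Haar calculus below consumes:
`ψ` is measurable and bounded, `t ↦ ψ(linkShift e v t U)` is differentiable at `t = 0` for EVERY configuration
`U`, and the resulting derivative `∂_{e,v} ψ` is measurable and bounded.  (For `v` blind to `e` the flow is a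
group, so differentiability at `0` everywhere is differentiability at every `t`, `hasDerivAt_linkShift`.)
Lüscher's standing assumption «differentiable function f(U) of the gauge field» (§2.1–§2.2) implies it on the
compact field manifold. [cite: Luscher2010Trivializing, §2.1–§2.2] -/
structure LinkRegular (e : Edge d L) (v : GaugeConfig d L SU2 → EuclideanSpace ℝ (Fin 3))
    (ψ : GaugeConfig d L SU2 → ℝ) : Prop where
  /-- `ψ` is measurable. -/
  measurable : Measurable ψ
  /-- `ψ` is bounded. -/
  bounded : ∃ C : ℝ, ∀ U, |ψ U| ≤ C
  /-- `t ↦ ψ(Φ_t U)` is differentiable at `t = 0` for every `U`. -/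
  differentiableAt : ∀ U, DifferentiableAt ℝ (fun t : ℝ => ψ (linkShift e v t U)) 0
  /-- the derivative `∂_{e,v} ψ` is measurable. -/
  measurable_linkDerivation : Measurable (linkDerivation e v ψ)
  /-- the derivative `∂_{e,v} ψ` is bounded. -/
  bounded_linkDerivation : ∃ C : ℝ, ∀ U, |linkDerivation e v ψ U| ≤ C

end Defs

/-! ## §2 The link flow: group property, derivatives at every time, measurability -/

section Flow

variable {d L : ℕ}

/-- Print's Pauli coordinates are homogeneous, `iΣσ_a(cA)^a = c·iΣσ_aA^a` (also in `B10Eq18SigmaSU2Chart`, whose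
chart imports this file avoids). [folklore] -/
private theorem su2Coord_smul' (c : ℝ) (x : Fin 3 → ℝ) :
    Balaban1983to89.B10Eq18SigmaSU2.su2Coord (c • x) = c • Balaban1983to89.B10Eq18SigmaSU2.su2Coord x := by
  rw [Balaban1983to89.B10Eq18SigmaSU2.su2Coord_eq_sum, Balaban1983to89.B10Eq18SigmaSU2.su2Coord_eq_sum,
    Finset.smul_sum]
  refine Finset.sum_congr rfl fun a _ => ?_
  rw [← smul_assoc, Complex.real_smul, Pi.smul_apply, smul_eq_mul, Complex.ofReal_mul, mul_assoc]

/-- The chart along a ray is a one-parameter group: `exp(i(t+s)A) = exp(itA)·exp(isA)`. [folklore] -/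
private theorem expPauli_add_smul (t s : ℝ) (w : EuclideanSpace ℝ (Fin 3)) :
    expPauli ((t + s) • w) = expPauli (t • w) * expPauli (s • w) := by
  apply Subtype.ext
  change NormedSpace.exp (Balaban1983to89.B10Eq18SigmaSU2.su2Coord ⇑((t + s) • w)) =
    NormedSpace.exp (Balaban1983to89.B10Eq18SigmaSU2.su2Coord ⇑(t • w)) *
      NormedSpace.exp (Balaban1983to89.B10Eq18SigmaSU2.su2Coord ⇑(s • w))
  rw [WithLp.ofLp_smul, WithLp.ofLp_smul, WithLp.ofLp_smul, su2Coord_smul', su2Coord_smul', su2Coord_smul',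
    add_smul]
  exact Matrix.exp_add_of_commute _ _
    (((Commute.refl (Balaban1983to89.B10Eq18SigmaSU2.su2Coord ⇑w)).smul_left t).smul_right s)

/-- At time `0` the flow is the identity: `exp(i·0) = 1`. [cite: Luscher2010Trivializing, §2.2 eq. (2.2)] -/
@[simp] theorem linkShift_zero (e : Edge d L) (v : GaugeConfig d L SU2 → EuclideanSpace ℝ (Fin 3))
    (U : GaugeConfig d L SU2) : linkShift e v 0 U = U := by
  simp [linkShift, expPauli_zero]

/-- The moved link: `(Φ_t U)(e) = U(e)·exp(itΣ v_a(U)σ_a)`. [cite: Luscher2010Trivializing, §2.2 eq. (2.2)] -/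
@[simp] theorem linkShift_apply_self (e : Edge d L) (v : GaugeConfig d L SU2 → EuclideanSpace ℝ (Fin 3))
    (t : ℝ) (U : GaugeConfig d L SU2) : linkShift e v t U e = U e * expPauli (t • v U) := by
  simp [linkShift]

/-- The other links are untouched. [cite: Luscher2010Trivializing, §2.2 eq. (2.2)] -/
theorem linkShift_apply_of_ne {e e' : Edge d L} (h : e' ≠ e)
    (v : GaugeConfig d L SU2 → EuclideanSpace ℝ (Fin 3)) (t : ℝ) (U : GaugeConfig d L SU2) :
    linkShift e v t U e' = U e' := by
  simp [linkShift, Function.update_of_ne h]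

/-- A direction field that depends only on the links other than `e` takes the same value along the flow of
`e`. [folklore] -/
private theorem eq_of_dependsOn_update {α : Type*} {G : Type*} {e : Edge d L} {v : GaugeConfig d L G → α}
    (hv : DependsOn v ({e}ᶜ : Set (Edge d L))) (U : GaugeConfig d L G) (g : G) :
    v (Function.update U e g) = v U :=
  hv fun i hi => by
    simp only [mem_compl_iff, mem_singleton_iff] at hi
    simp [Function.update_of_ne hi]

/-- The direction read off the flowed configuration is the direction read off the initial one (blind field).
[cite: Luscher2010Trivializing, §2.2 eq. (2.2)] -/
theorem dir_linkShift {e : Edge d L} {v : GaugeConfig d L SU2 → EuclideanSpace ℝ (Fin 3)}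
    (hv : DependsOn v ({e}ᶜ : Set (Edge d L))) (t : ℝ) (U : GaugeConfig d L SU2) :
    v (linkShift e v t U) = v U :=
  eq_of_dependsOn_update hv U _

/-- **Group property of the link flow** (blind direction field): `Φ_s (Φ_t U) = Φ_{t+s} U`.
[cite: Luscher2010Trivializing, §2.2 eq. (2.2)] -/
theorem linkShift_linkShift {e : Edge d L} {v : GaugeConfig d L SU2 → EuclideanSpace ℝ (Fin 3)}
    (hv : DependsOn v ({e}ᶜ : Set (Edge d L))) (s t : ℝ) (U : GaugeConfig d L SU2) :
    linkShift e v s (linkShift e v t U) = linkShift e v (t + s) U := by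
  have hdir := dir_linkShift hv t U
  unfold linkShift at hdir ⊢
  rw [hdir, Function.update_idem, Function.update_self, mul_assoc, ← expPauli_add_smul]

/-- **Derivative at every time from the derivative at time zero.** For a blind direction field, if
`t ↦ ψ(Φ_t V)` is differentiable at `0` for every `V`, then `t ↦ ψ(Φ_t U)` has derivative
`(∂_{e,v} ψ)(Φ_t U)` at every `t`. [cite: Luscher2010Trivializing, §2.2 eq. (2.2)] -/
theorem hasDerivAt_linkShift {e : Edge d L} {v : GaugeConfig d L SU2 → EuclideanSpace ℝ (Fin 3)}
    (hv : DependsOn v ({e}ᶜ : Set (Edge d L))) {ψ : GaugeConfig d L SU2 → ℝ}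
    (hψ : ∀ V, DifferentiableAt ℝ (fun t : ℝ => ψ (linkShift e v t V)) 0) (U : GaugeConfig d L SU2) (t : ℝ) :
    HasDerivAt (fun s : ℝ => ψ (linkShift e v s U)) (linkDerivation e v ψ (linkShift e v t U)) t := by
  have hg : HasDerivAt (fun h : ℝ => ψ (linkShift e v h (linkShift e v t U)))
      (linkDerivation e v ψ (linkShift e v t U)) (t + -t) := by
    rw [add_neg_cancel]
    exact (hψ (linkShift e v t U)).hasDerivAt
  have hcomp := HasDerivAt.comp_add_const t (-t) hg
  have hfun : (fun s : ℝ => ψ (linkShift e v (s + -t) (linkShift e v t U))) = fun s => ψ (linkShift e v s U) := by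
    funext s
    rw [linkShift_linkShift hv, show t + (s + -t) = s by ring]
  rw [hfun] at hcomp
  exact hcomp

/-- The link flow `U ↦ U_t` is measurable (for a measurable direction field).
[cite: Luscher2010Trivializing, §2.2 eq. (2.2)] -/
theorem measurable_linkShift (e : Edge d L) {v : GaugeConfig d L SU2 → EuclideanSpace ℝ (Fin 3)}
    (hv : Measurable v) (t : ℝ) : Measurable (linkShift e v t) := by
  have hmul : Measurable fun U : GaugeConfig d L SU2 => U e * expPauli (t • v U) :=
    (measurable_pi_apply e).mul (measurable_expPauli.comp ((continuous_const_smul t).measurable.comp hv))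
  exact measurable_update'.comp (measurable_id.prodMk hmul)

end Flow

/-! ## §3 Haar divergence-freeness: blind right translations of one link preserve the product Haar measure -/

section Haar

variable {d L : ℕ} [NeZero L]

section General

variable {G : Type*} [Group G] [TopologicalSpace G] [IsTopologicalGroup G] [CompactSpace G]
  [MeasurableSpace G] [BorelSpace G]

/-- **Renaming move, measure form.** Right-multiplying ONE link by a measurable group element read off the
OTHER links, `U ↦ (U with U(e) ↦ U(e)·k(U))`, `k` blind to `e`, preserves the product Haar measure
`Π_e dU(e)`: under the other links this is the right invariance `∫ f(UV) dU = ∫ f(U) dU` of the one-link Haar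
measure. [cite: MontvayMunster1994, §3.2.3 eq. (3.90)] -/
theorem map_linkMul_pi_haarProbability [MeasurableMul₂ G] (e : Edge d L) {k : GaugeConfig d L G → G}
    (hk : Measurable k) (hke : DependsOn k ({e}ᶜ : Set (Edge d L))) :
    Measure.map (fun U : GaugeConfig d L G => Function.update U e (U e * k U))
        (Measure.pi fun _ : Edge d L => haarProbability G) =
      Measure.pi fun _ : Edge d L => haarProbability G := by
  have hΦm : Measurable fun U : GaugeConfig d L G => Function.update U e (U e * k U) :=
    measurable_update'.comp (measurable_id.prodMk ((measurable_pi_apply e).mul hk))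
  refine Measure.ext fun s hs => ?_
  rw [Measure.map_apply hΦm hs, ← lintegral_indicator_one (hΦm hs), ← lintegral_indicator_one hs]
  have key := YM2.lintegral_eq_of_update_mul (G := G) (e := e)
    (Φ := fun U : GaugeConfig d L G => s.indicator (1 : GaugeConfig d L G → ℝ≥0∞)
      (Function.update U e (U e * k U)))
    (Φ' := s.indicator (1 : GaugeConfig d L G → ℝ≥0∞))
    ((measurable_one.indicator hs).comp hΦm) (measurable_one.indicator hs) k fun U x => by
      simp only [Function.update_idem, Function.update_self, eq_of_dependsOn_update hke]
  exact key

/-- **Renaming move, integral form**: `∫ ψ(U with U(e) ↦ U(e)·k(U)) Π dU = ∫ ψ Π dU` for `k` measurable and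
blind to `e`, `ψ` (ae-strongly) measurable. [cite: MontvayMunster1994, §3.2.3 eq. (3.90)] -/
theorem integral_comp_linkMul_pi_haarProbability [MeasurableMul₂ G] {E : Type*} [NormedAddCommGroup E]
    [NormedSpace ℝ E] (e : Edge d L) {k : GaugeConfig d L G → G} (hk : Measurable k)
    (hke : DependsOn k ({e}ᶜ : Set (Edge d L))) {ψ : GaugeConfig d L G → E}
    (hψ : AEStronglyMeasurable ψ (Measure.pi fun _ : Edge d L => haarProbability G)) :
    ∫ U, ψ (Function.update U e (U e * k U)) ∂(Measure.pi fun _ : Edge d L => haarProbability G) =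
      ∫ U, ψ U ∂(Measure.pi fun _ : Edge d L => haarProbability G) := by
  have hΦm : Measurable fun U : GaugeConfig d L G => Function.update U e (U e * k U) :=
    measurable_update'.comp (measurable_id.prodMk ((measurable_pi_apply e).mul hk))
  have hmap := map_linkMul_pi_haarProbability e hk hke
  rw [← integral_map hΦm.aemeasurable (by rw [hmap]; exact hψ), hmap]

end General

/-- **The link flow preserves the product Haar measure** (blind, measurable direction field): the
`SU(2)`/Pauli-chart instance of the renaming move. [cite: MontvayMunster1994, §3.2.3 eq. (3.90)] -/
theorem measurePreserving_linkShift (e : Edge d L) {v : GaugeConfig d L SU2 → EuclideanSpace ℝ (Fin 3)}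
    (hv : Measurable v) (hve : DependsOn v ({e}ᶜ : Set (Edge d L))) (t : ℝ) :
    MeasurePreserving (linkShift e v t) (Measure.pi fun _ : Edge d L => haarProbability SU2)
      (Measure.pi fun _ : Edge d L => haarProbability SU2) := by
  refine ⟨measurable_linkShift e hv t, ?_⟩
  exact map_linkMul_pi_haarProbability e
    (measurable_expPauli.comp ((continuous_const_smul t).measurable.comp hv))
    fun U U' h => by
      show expPauli (t • v U) = expPauli (t • v U')
      rw [hve h]

/-- **Flow invariance of Haar integrals**: `∫ ψ(Φ_t U) Π dU = ∫ ψ Π dU` for every `t`.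
[cite: MontvayMunster1994, §3.2.3 eq. (3.90)] -/
theorem integral_comp_linkShift (e : Edge d L) {v : GaugeConfig d L SU2 → EuclideanSpace ℝ (Fin 3)}
    (hv : Measurable v) (hve : DependsOn v ({e}ᶜ : Set (Edge d L))) (t : ℝ)
    {ψ : GaugeConfig d L SU2 → ℝ} (hψ : Measurable ψ) :
    ∫ U, ψ (linkShift e v t U) ∂(Measure.pi fun _ : Edge d L => haarProbability SU2) =
      ∫ U, ψ U ∂(Measure.pi fun _ : Edge d L => haarProbability SU2) :=
  integral_comp_linkMul_pi_haarProbability e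
    (measurable_expPauli.comp ((continuous_const_smul t).measurable.comp hv))
    (fun U U' h => by
      show expPauli (t • v U) = expPauli (t • v U')
      rw [hve h]) hψ.aestronglyMeasurable

end Haar

/-! ## §4 Integration by parts: `∫ ∂_{e,v} ψ Π dU = 0` and `∫ X_c ψ Π dU = 0` -/

section IBP

variable {d L : ℕ} [NeZero L]

/-- Bounded measurable functions are integrable for the (probability) product Haar measure. [folklore] -/
private theorem integrable_of_bdd {ψ : GaugeConfig d L SU2 → ℝ} (hm : Measurable ψ)
    (hb : ∃ C : ℝ, ∀ U, |ψ U| ≤ C) :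
    Integrable ψ (Measure.pi fun _ : Edge d L => haarProbability SU2) := by
  obtain ⟨C, hC⟩ := hb
  exact ⟨hm.aestronglyMeasurable, .of_bounded (C := C) (ae_of_all _ fun U => by
    rw [Real.norm_eq_abs]; exact hC U)⟩

/-- A product of bounded functions is bounded. [folklore] -/
private theorem bdd_mul {α : Type*} {f g : α → ℝ} (hf : ∃ C : ℝ, ∀ U, |f U| ≤ C)
    (hg : ∃ C : ℝ, ∀ U, |g U| ≤ C) : ∃ C : ℝ, ∀ U, |f U * g U| ≤ C := by
  obtain ⟨A, hA⟩ := hf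
  obtain ⟨B, hB⟩ := hg
  refine ⟨A * B, fun U => ?_⟩
  rw [abs_mul]
  exact mul_le_mul (hA U) (hB U) (abs_nonneg _) ((abs_nonneg _).trans (hA U))

/-- The link derivation of a regular function is integrable. [cite: Luscher2010Trivializing, §2.2 eq. (2.2)] -/
theorem LinkRegular.integrable_linkDerivation {e : Edge d L}
    {v : GaugeConfig d L SU2 → EuclideanSpace ℝ (Fin 3)} {ψ : GaugeConfig d L SU2 → ℝ}
    (hψ : LinkRegular e v ψ) :
    Integrable (linkDerivation e v ψ) (Measure.pi fun _ : Edge d L => haarProbability SU2) :=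
  integrable_of_bdd hψ.measurable_linkDerivation hψ.bounded_linkDerivation

/-- **INTEGRATION BY PARTS ALONG ONE LINK: `∫ (∂_{e,v} ψ)(U) Π dU = 0`** for a measurable direction field
`v` blind to `e` and `ψ` regular along the flow.  Proof (as printed for `∂^a_{x,μ}`): `t ↦ ∫ ψ(Φ_t U) Π dU` is
constant by right invariance of the Haar measure of the link `e` (§3), and its derivative at `t = 0` is
`∫ ∂_{e,v} ψ` by differentiation under the integral sign (dominated convergence; the derivative at time `t` is
`(∂_{e,v} ψ)(Φ_t U)` by the group property, uniformly bounded).  This is the identity that makes Lüscher's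
`Σ ∂^a∂^a` symmetric and non-negative in `L²(D[U])`.
[cite: Luscher2010Trivializing, §2.2 eq. (2.2) and §4.2 eqs. (4.7)–(4.8)] -/
theorem integral_linkDerivation_eq_zero (e : Edge d L) {v : GaugeConfig d L SU2 → EuclideanSpace ℝ (Fin 3)}
    (hv : Measurable v) (hve : DependsOn v ({e}ᶜ : Set (Edge d L))) {ψ : GaugeConfig d L SU2 → ℝ}
    (hψ : LinkRegular e v ψ) :
    ∫ U, linkDerivation e v ψ U ∂(Measure.pi fun _ : Edge d L => haarProbability SU2) = 0 := by
  set μ : Measure (GaugeConfig d L SU2) := Measure.pi fun _ : Edge d L => haarProbability SU2 with hμ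
  obtain ⟨C, hC⟩ := hψ.bounded_linkDerivation
  have hconst : ∀ t : ℝ, ∫ U, ψ (linkShift e v t U) ∂μ = ∫ U, ψ U ∂μ := fun t =>
    integral_comp_linkShift e hv hve t hψ.measurable
  have hint0 : Integrable (fun U => ψ (linkShift e v 0 U)) μ := by
    simpa only [linkShift_zero] using integrable_of_bdd hψ.measurable hψ.bounded
  have hmain := hasDerivAt_integral_of_dominated_loc_of_deriv_le (μ := μ)
    (F := fun (t : ℝ) (U : GaugeConfig d L SU2) => ψ (linkShift e v t U))
    (F' := fun (t : ℝ) (U : GaugeConfig d L SU2) => linkDerivation e v ψ (linkShift e v t U))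
    (x₀ := (0 : ℝ)) (s := univ) (bound := fun _ => C) univ_mem
    (Eventually.of_forall fun t => (hψ.measurable.comp (measurable_linkShift e hv t)).aestronglyMeasurable)
    hint0 ((hψ.measurable_linkDerivation.comp (measurable_linkShift e hv 0)).aestronglyMeasurable)
    (ae_of_all _ fun U t _ => by rw [Real.norm_eq_abs]; exact hC (linkShift e v t U))
    (integrable_const C) (ae_of_all _ fun U t _ => hasDerivAt_linkShift hve hψ.differentiableAt U t)
  have hzero : HasDerivAt (fun t : ℝ => ∫ U, ψ (linkShift e v t U) ∂μ) 0 0 := by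
    have h : (fun t : ℝ => ∫ U, ψ (linkShift e v t U) ∂μ) = fun _ => ∫ U, ψ U ∂μ := funext hconst
    rw [h]
    exact hasDerivAt_const _ _
  have heq : ∫ U, linkDerivation e v ψ (linkShift e v 0 U) ∂μ = 0 := hmain.2.unique hzero
  simpa only [linkShift_zero] using heq

/-- The transport derivation of a function regular along every direction-`0` link is integrable.
[cite: Luscher2010Trivializing, §2.2 eqs. (2.2)–(2.4)] -/
theorem integrable_transportDerivation {c : Site 3 L → GaugeConfig 3 L SU2 → EuclideanSpace ℝ (Fin 3)}
    {ψ : GaugeConfig 3 L SU2 → ℝ} (hψ : ∀ x, LinkRegular (x, (0 : Fin 3)) (c x) ψ) :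
    Integrable (transportDerivation c ψ) (Measure.pi fun _ : Edge 3 L => haarProbability SU2) := by
  have h : transportDerivation c ψ = fun U => ∑ x : Site 3 L, linkDerivation (x, (0 : Fin 3)) (c x) ψ U :=
    funext fun U => transportDerivation_eq_sum_linkDerivation c ψ U
  rw [h]
  exact integrable_finsetSum _ fun x _ => (hψ x).integrable_linkDerivation

/-- **HAAR DIVERGENCE-FREENESS OF THE TRANSPORT FIELD: `∫ (X_c ψ)(U) Π dU = 0`** when every frame `c x` is
measurable and AVOIDS THE LINK it moves (`c x` does not read `U(x,0)`) and `ψ` is regular along each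
direction-`0` link — the vector field `X_c = Σ_x (c x)^a ∂^a_{(x,0)}` has zero divergence for the product
Haar measure, so `∫ X_c ψ = 0` (sum of the one-link identities).
[cite: Luscher2010Trivializing, §2.2 eqs. (2.2)–(2.4) and §4.2 eqs. (4.7)–(4.8)] -/
theorem integral_transportDerivation_eq_zero
    {c : Site 3 L → GaugeConfig 3 L SU2 → EuclideanSpace ℝ (Fin 3)} (hc : ∀ x, Measurable (c x))
    (hce : ∀ x, DependsOn (c x) ({(x, (0 : Fin 3))}ᶜ : Set (Edge 3 L))) {ψ : GaugeConfig 3 L SU2 → ℝ}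
    (hψ : ∀ x, LinkRegular (x, (0 : Fin 3)) (c x) ψ) :
    ∫ U, transportDerivation c ψ U ∂(Measure.pi fun _ : Edge 3 L => haarProbability SU2) = 0 := by
  have h : transportDerivation c ψ = fun U => ∑ x : Site 3 L, linkDerivation (x, (0 : Fin 3)) (c x) ψ U :=
    funext fun U => transportDerivation_eq_sum_linkDerivation c ψ U
  rw [h, integral_finsetSum _ fun x _ => (hψ x).integrable_linkDerivation]
  exact Finset.sum_eq_zero fun x _ => integral_linkDerivation_eq_zero _ (hc x) (hce x) (hψ x)

end IBP

/-! ## §5 Product rule, algebra of regular functions, antisymmetry -/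

section Leibniz

variable {d L : ℕ}

/-- **Product rule along one link**: `∂_{e,v}(fg) = (∂_{e,v} f) g + f (∂_{e,v} g)` wherever both flows are
differentiable at `t = 0`. [cite: Luscher2010Trivializing, §2.2 eq. (2.2)] -/
theorem linkDerivation_mul (e : Edge d L) (v : GaugeConfig d L SU2 → EuclideanSpace ℝ (Fin 3))
    {f g : GaugeConfig d L SU2 → ℝ} (U : GaugeConfig d L SU2)
    (hf : DifferentiableAt ℝ (fun t : ℝ => f (linkShift e v t U)) 0)
    (hg : DifferentiableAt ℝ (fun t : ℝ => g (linkShift e v t U)) 0) :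
    linkDerivation e v (fun U => f U * g U) U = linkDerivation e v f U * g U + f U * linkDerivation e v g U := by
  have h := (hf.hasDerivAt.mul hg.hasDerivAt).deriv
  simp only [linkShift_zero] at h
  exact h

/-- Sum rule along one link. [cite: Luscher2010Trivializing, §2.2 eq. (2.2)] -/
theorem linkDerivation_add (e : Edge d L) (v : GaugeConfig d L SU2 → EuclideanSpace ℝ (Fin 3))
    {f g : GaugeConfig d L SU2 → ℝ} (U : GaugeConfig d L SU2)
    (hf : DifferentiableAt ℝ (fun t : ℝ => f (linkShift e v t U)) 0)
    (hg : DifferentiableAt ℝ (fun t : ℝ => g (linkShift e v t U)) 0) :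
    linkDerivation e v (fun U => f U + g U) U = linkDerivation e v f U + linkDerivation e v g U :=
  (hf.hasDerivAt.add hg.hasDerivAt).deriv

/-- Constants have zero link derivative. [cite: Luscher2010Trivializing, §2.2 eq. (2.2)] -/
@[simp] theorem linkDerivation_const (e : Edge d L) (v : GaugeConfig d L SU2 → EuclideanSpace ℝ (Fin 3))
    (a : ℝ) (U : GaugeConfig d L SU2) : linkDerivation e v (fun _ => a) U = 0 := by
  simp [linkDerivation]

/-- Scalars come out of the link derivative. [cite: Luscher2010Trivializing, §2.2 eq. (2.2)] -/
theorem linkDerivation_const_mul (e : Edge d L) (v : GaugeConfig d L SU2 → EuclideanSpace ℝ (Fin 3))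
    (a : ℝ) (f : GaugeConfig d L SU2 → ℝ) (U : GaugeConfig d L SU2) :
    linkDerivation e v (fun U => a * f U) U = a * linkDerivation e v f U :=
  deriv_const_mul_field a

/-- **Product rule for the transport derivation**: `X(fg) = (Xf) g + f (Xg)`.
[cite: Luscher2010Trivializing, §2.2 eqs. (2.2)–(2.4)] -/
theorem transportDerivation_mul [NeZero L] (c : Site 3 L → GaugeConfig 3 L SU2 → EuclideanSpace ℝ (Fin 3))
    {f g : GaugeConfig 3 L SU2 → ℝ} (U : GaugeConfig 3 L SU2)
    (hf : ∀ x, DifferentiableAt ℝ (fun t : ℝ => f (linkShift (x, (0 : Fin 3)) (c x) t U)) 0)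
    (hg : ∀ x, DifferentiableAt ℝ (fun t : ℝ => g (linkShift (x, (0 : Fin 3)) (c x) t U)) 0) :
    transportDerivation c (fun U => f U * g U) U =
      transportDerivation c f U * g U + f U * transportDerivation c g U := by
  simp only [transportDerivation_eq_sum_linkDerivation, Finset.sum_mul, Finset.mul_sum,
    ← Finset.sum_add_distrib]
  exact Finset.sum_congr rfl fun x _ => linkDerivation_mul _ _ U (hf x) (hg x)

/-- Sum rule for the transport derivation. [cite: Luscher2010Trivializing, §2.2 eqs. (2.2)–(2.4)] -/
theorem transportDerivation_add [NeZero L] (c : Site 3 L → GaugeConfig 3 L SU2 → EuclideanSpace ℝ (Fin 3))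
    {f g : GaugeConfig 3 L SU2 → ℝ} (U : GaugeConfig 3 L SU2)
    (hf : ∀ x, DifferentiableAt ℝ (fun t : ℝ => f (linkShift (x, (0 : Fin 3)) (c x) t U)) 0)
    (hg : ∀ x, DifferentiableAt ℝ (fun t : ℝ => g (linkShift (x, (0 : Fin 3)) (c x) t U)) 0) :
    transportDerivation c (fun U => f U + g U) U = transportDerivation c f U + transportDerivation c g U := by
  simp only [transportDerivation_eq_sum_linkDerivation, ← Finset.sum_add_distrib]
  exact Finset.sum_congr rfl fun x _ => linkDerivation_add _ _ U (hf x) (hg x)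

/-- Constants are annihilated by the transport derivation.
[cite: Luscher2010Trivializing, §2.2 eqs. (2.2)–(2.4)] -/
@[simp] theorem transportDerivation_const [NeZero L]
    (c : Site 3 L → GaugeConfig 3 L SU2 → EuclideanSpace ℝ (Fin 3)) (a : ℝ) (U : GaugeConfig 3 L SU2) :
    transportDerivation c (fun _ => a) U = 0 := by
  simp [transportDerivation_eq_sum_linkDerivation]

/-- Constants are regular along every link flow. [cite: Luscher2010Trivializing, §2.1–§2.2] -/
theorem LinkRegular.const (e : Edge d L) (v : GaugeConfig d L SU2 → EuclideanSpace ℝ (Fin 3)) (a : ℝ) :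
    LinkRegular e v (fun _ => a) where
  measurable := measurable_const
  bounded := ⟨|a|, fun _ => le_rfl⟩
  differentiableAt := fun _ => differentiableAt_const a
  measurable_linkDerivation := by
    have h : linkDerivation e v (fun _ : GaugeConfig d L SU2 => a) = fun _ => 0 :=
      funext fun U => linkDerivation_const e v a U
    rw [h]
    exact measurable_const
  bounded_linkDerivation := ⟨0, fun U => by simp⟩

/-- Regular functions along a link flow form an algebra: sums. [cite: Luscher2010Trivializing, §2.1–§2.2] -/
theorem LinkRegular.add {e : Edge d L} {v : GaugeConfig d L SU2 → EuclideanSpace ℝ (Fin 3)}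
    {f g : GaugeConfig d L SU2 → ℝ} (hf : LinkRegular e v f) (hg : LinkRegular e v g) :
    LinkRegular e v (fun U => f U + g U) := by
  have hD : linkDerivation e v (fun U => f U + g U) =
      fun U => linkDerivation e v f U + linkDerivation e v g U :=
    funext fun U => linkDerivation_add e v U (hf.differentiableAt U) (hg.differentiableAt U)
  obtain ⟨A, hA⟩ := hf.bounded
  obtain ⟨B, hB⟩ := hg.bounded
  obtain ⟨A', hA'⟩ := hf.bounded_linkDerivation
  obtain ⟨B', hB'⟩ := hg.bounded_linkDerivation
  exact
  { measurable := hf.measurable.fun_add hg.measurable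
    bounded := ⟨A + B, fun U => (abs_add_le _ _).trans (add_le_add (hA U) (hB U))⟩
    differentiableAt := fun U => (hf.differentiableAt U).add (hg.differentiableAt U)
    measurable_linkDerivation := by
      rw [hD]
      exact hf.measurable_linkDerivation.fun_add hg.measurable_linkDerivation
    bounded_linkDerivation := ⟨A' + B', fun U => by
      rw [hD]
      exact (abs_add_le _ _).trans (add_le_add (hA' U) (hB' U))⟩ }

/-- Regular functions along a link flow form an algebra: scalar multiples.
[cite: Luscher2010Trivializing, §2.1–§2.2] -/
theorem LinkRegular.const_mul {e : Edge d L} {v : GaugeConfig d L SU2 → EuclideanSpace ℝ (Fin 3)}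
    {f : GaugeConfig d L SU2 → ℝ} (hf : LinkRegular e v f) (a : ℝ) :
    LinkRegular e v (fun U => a * f U) := by
  have hD : linkDerivation e v (fun U => a * f U) = fun U => a * linkDerivation e v f U :=
    funext fun U => linkDerivation_const_mul e v a f U
  obtain ⟨A, hA⟩ := hf.bounded
  obtain ⟨A', hA'⟩ := hf.bounded_linkDerivation
  exact
  { measurable := hf.measurable.const_mul a
    bounded := ⟨|a| * A, fun U => by rw [abs_mul]; exact mul_le_mul_of_nonneg_left (hA U) (abs_nonneg a)⟩
    differentiableAt := fun U => (hf.differentiableAt U).const_mul a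
    measurable_linkDerivation := by
      rw [hD]
      exact hf.measurable_linkDerivation.const_mul a
    bounded_linkDerivation := ⟨|a| * A', fun U => by
      rw [hD, abs_mul]
      exact mul_le_mul_of_nonneg_left (hA' U) (abs_nonneg a)⟩ }

/-- Regular functions along a link flow form an algebra: products (Leibniz).
[cite: Luscher2010Trivializing, §2.1–§2.2] -/
theorem LinkRegular.mul {e : Edge d L} {v : GaugeConfig d L SU2 → EuclideanSpace ℝ (Fin 3)}
    {f g : GaugeConfig d L SU2 → ℝ} (hf : LinkRegular e v f) (hg : LinkRegular e v g) :
    LinkRegular e v (fun U => f U * g U) := by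
  have hD : linkDerivation e v (fun U => f U * g U) =
      fun U => linkDerivation e v f U * g U + f U * linkDerivation e v g U :=
    funext fun U => linkDerivation_mul e v U (hf.differentiableAt U) (hg.differentiableAt U)
  obtain ⟨C₁, hC₁⟩ := bdd_mul hf.bounded_linkDerivation hg.bounded
  obtain ⟨C₂, hC₂⟩ := bdd_mul hf.bounded hg.bounded_linkDerivation
  exact
  { measurable := hf.measurable.fun_mul hg.measurable
    bounded := bdd_mul hf.bounded hg.bounded
    differentiableAt := fun U => (hf.differentiableAt U).mul (hg.differentiableAt U)
    measurable_linkDerivation := by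
      rw [hD]
      exact (hf.measurable_linkDerivation.mul hg.measurable).add (hf.measurable.fun_mul hg.measurable_linkDerivation)
    bounded_linkDerivation := ⟨C₁ + C₂, fun U => by
      rw [hD]
      exact (abs_add_le _ _).trans (add_le_add (hC₁ U) (hC₂ U))⟩ }

variable [NeZero L]

/-- **Antisymmetry along one link**: `∫ (∂_{e,v} f) g Π dU = −∫ f (∂_{e,v} g) Π dU` (integration by parts
applied to `fg`). [cite: Luscher2010Trivializing, §4.2 eqs. (4.7)–(4.8)] -/
theorem integral_linkDerivation_mul_eq_neg (e : Edge d L) {v : GaugeConfig d L SU2 → EuclideanSpace ℝ (Fin 3)}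
    (hv : Measurable v) (hve : DependsOn v ({e}ᶜ : Set (Edge d L))) {f g : GaugeConfig d L SU2 → ℝ}
    (hf : LinkRegular e v f) (hg : LinkRegular e v g) :
    ∫ U, linkDerivation e v f U * g U ∂(Measure.pi fun _ : Edge d L => haarProbability SU2) =
      -∫ U, f U * linkDerivation e v g U ∂(Measure.pi fun _ : Edge d L => haarProbability SU2) := by
  have h := integral_linkDerivation_eq_zero e hv hve (hf.mul hg)
  have hD : linkDerivation e v (fun U => f U * g U) =
      fun U => linkDerivation e v f U * g U + f U * linkDerivation e v g U :=
    funext fun U => linkDerivation_mul e v U (hf.differentiableAt U) (hg.differentiableAt U)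
  have i1 : Integrable (fun U => linkDerivation e v f U * g U) (Measure.pi fun _ : Edge d L => haarProbability SU2) :=
    integrable_of_bdd (hf.measurable_linkDerivation.fun_mul hg.measurable) (bdd_mul hf.bounded_linkDerivation hg.bounded)
  have i2 : Integrable (fun U => f U * linkDerivation e v g U) (Measure.pi fun _ : Edge d L => haarProbability SU2) :=
    integrable_of_bdd (hf.measurable.fun_mul hg.measurable_linkDerivation) (bdd_mul hf.bounded hg.bounded_linkDerivation)
  have hsum : ∫ U, linkDerivation e v (fun U => f U * g U) U ∂(Measure.pi fun _ : Edge d L => haarProbability SU2) =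
      (∫ U, linkDerivation e v f U * g U ∂(Measure.pi fun _ : Edge d L => haarProbability SU2)) +
        ∫ U, f U * linkDerivation e v g U ∂(Measure.pi fun _ : Edge d L => haarProbability SU2) := by
    rw [hD]
    exact integral_add i1 i2
  rw [hsum] at h
  linarith

/-- **Antisymmetry of the transport derivation in `L²(Π dU)`**: `∫ (X_c f) g = −∫ f (X_c g)` for frames
avoiding their links and `f`, `g` regular along every direction-`0` link.
[cite: Luscher2010Trivializing, §4.2 eqs. (4.7)–(4.8)] -/
theorem integral_transportDerivation_mul_eq_neg
    {c : Site 3 L → GaugeConfig 3 L SU2 → EuclideanSpace ℝ (Fin 3)} (hc : ∀ x, Measurable (c x))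
    (hce : ∀ x, DependsOn (c x) ({(x, (0 : Fin 3))}ᶜ : Set (Edge 3 L))) {f g : GaugeConfig 3 L SU2 → ℝ}
    (hf : ∀ x, LinkRegular (x, (0 : Fin 3)) (c x) f) (hg : ∀ x, LinkRegular (x, (0 : Fin 3)) (c x) g) :
    ∫ U, transportDerivation c f U * g U ∂(Measure.pi fun _ : Edge 3 L => haarProbability SU2) =
      -∫ U, f U * transportDerivation c g U ∂(Measure.pi fun _ : Edge 3 L => haarProbability SU2) := by
  have h1 : (fun U => transportDerivation c f U * g U) =
      fun U => ∑ x : Site 3 L, linkDerivation (x, (0 : Fin 3)) (c x) f U * g U := by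
    funext U
    rw [transportDerivation_eq_sum_linkDerivation, Finset.sum_mul]
  have h2 : (fun U => f U * transportDerivation c g U) =
      fun U => ∑ x : Site 3 L, f U * linkDerivation (x, (0 : Fin 3)) (c x) g U := by
    funext U
    rw [transportDerivation_eq_sum_linkDerivation, Finset.mul_sum]
  have i1 : ∀ x : Site 3 L, Integrable (fun U => linkDerivation (x, (0 : Fin 3)) (c x) f U * g U)
      (Measure.pi fun _ : Edge 3 L => haarProbability SU2) := fun x =>
    integrable_of_bdd ((hf x).measurable_linkDerivation.fun_mul (hg x).measurable)
      (bdd_mul (hf x).bounded_linkDerivation (hg x).bounded)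
  have i2 : ∀ x : Site 3 L, Integrable (fun U => f U * linkDerivation (x, (0 : Fin 3)) (c x) g U)
      (Measure.pi fun _ : Edge 3 L => haarProbability SU2) := fun x =>
    integrable_of_bdd ((hf x).measurable.fun_mul (hg x).measurable_linkDerivation)
      (bdd_mul (hf x).bounded (hg x).bounded_linkDerivation)
  rw [h1, h2, integral_finsetSum _ fun x _ => i1 x, integral_finsetSum _ fun x _ => i2 x,
    ← Finset.sum_neg_distrib]
  exact Finset.sum_congr rfl fun x _ => integral_linkDerivation_mul_eq_neg _ (hc x) (hce x) (hf x) (hg x)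

/-- **`⟨X_c Ω, Ω⟩ = ∫ (X_c Ω) Ω Π dU = 0`**: a divergence-free derivation is antisymmetric, so its diagonal
matrix elements vanish (take `f = g = Ω`). [cite: Luscher2010Trivializing, §4.2 eqs. (4.7)–(4.8)] -/
theorem integral_transportDerivation_mul_self_eq_zero
    {c : Site 3 L → GaugeConfig 3 L SU2 → EuclideanSpace ℝ (Fin 3)} (hc : ∀ x, Measurable (c x))
    (hce : ∀ x, DependsOn (c x) ({(x, (0 : Fin 3))}ᶜ : Set (Edge 3 L))) {Ω : GaugeConfig 3 L SU2 → ℝ}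
    (hΩ : ∀ x, LinkRegular (x, (0 : Fin 3)) (c x) Ω) :
    ∫ U, transportDerivation c Ω U * Ω U ∂(Measure.pi fun _ : Edge 3 L => haarProbability SU2) = 0 := by
  have h := integral_transportDerivation_mul_eq_neg hc hce hΩ hΩ
  have hcomm : (fun U => Ω U * transportDerivation c Ω U) = fun U => transportDerivation c Ω U * Ω U :=
    funext fun U => mul_comm _ _
  rw [hcomm] at h
  linarith

end Leibniz

end Literature.MathematicalPhysics.QuantumFieldTheory.LinkTransport
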